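import Summits.FinalStateConjecture.FinalStateConjecture.Theorems.PhotonSphereChannelsExteriorEnergyRW

/-!
# Route PhotonSphereChannels — outgoing-energy exhaustion from space-time bounds on the inward null
# energies of the two quadrants

Helper file for sub-goal `stub_compactExhaustionOfLocalDecay` of stub H4 of line `isolated-kerr-connected-hull`
(crux stmt-FinalStateConjecture-14075), over the Literature vocabulary
`ReggeWheeler.{energyDensity, IsSolution, exteriorEnergy, channelEnergy, totalEnergy}`.  For a global `C²`
solution `ψ` of `ψ_tt − ψ_xx + Vψ = 0`, `V ≥ 0` differentiable, and a centre `xc`: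

* `RW.integral_coneInterior_eq_flux` — the energy inside the light cone of `(B, xc)` at time `B + t` is the
  flux swept through its two sheets, `∫_{xc−t}^{xc+t} e(B+t,·) = ∫_0^t [((ψ_t+ψ_x)² + Vψ²)(B+σ, xc+σ)
  + ((ψ_t−ψ_x)² + Vψ²)(B+σ, xc−σ)] dσ` (affine energy identity on the bounded triangle — no squeeze);
* `RW.totalEnergy_eq_exteriorEnergy_shift_add` — `E(B+t) = exteriorEnergy V xc 0 (ψ(B+·)) t + ofReal (that)`;
* `RW.mul_coneInterior_le_of_quadrantBounds` — if the space-time integrals of `(ψ_t+ψ_x)² + Vψ²` over the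
  boxes `[0,T] × [xc, R]` and of `(ψ_t−ψ_x)² + Vψ²` over `[0,T] × [L, xc]` are bounded by `Q_R`, `Q_L`
  uniformly in `T ≥ 0`, `R ≥ xc`, `L ≤ xc`, then `B · ∫_{xc−t}^{xc+t} e(B+t,·) ≤ Q_R + Q_L` for `B > 0`,
  `t ≥ 0` (cone nesting, Fubini on rectangles, translations — real-valued throughout);
* `RW.tendsto_channelEnergy_shift_of_quadrantBounds` — **hence the forward channel energy of `ψ(B + ·)`
  through the bare light cone about `xc` tends to the (conserved) total energy as `B → +∞`** (H4 for such
  `ψ`): `E − ofReal ((Q_R + Q_L)/B) ≤ channelEnergy ≤ E`.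

(Total-energy conservation and the time-shift of solutions are re-derived here as `private` lemmas from
`…ExteriorEnergyRW`-level material so that this file does not depend on the build of `…RSilenceReduction` /
`…RTotalEnergyConservation`, where the public versions live.)  No definitions. [folklore]
-/

namespace Summit.FinalStateConjecture.FinalStateConjecture.Theorems

-- every `Summit.FinalStateConjecture.FinalStateConjecture.…` name repeats the summit = sub-problem
-- segment (D-0017 layout), as in every landed `…Theorems` file of this route
set_option linter.dupNamespace false

open MeasureTheory Set Filter Topology intervalIntegral
open Literature.Geometry.Lorentzian Literature.Geometry.Lorentzian.ReggeWheeler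

noncomputable section

namespace RW

section General

variable {V : ℝ → ℝ} {ψ : ℝ → ℝ → ℝ}

/-! ### Private copies: dictionary, conservation of the total energy, time shifts -/

/-- Dictionary (`he` format of the `WaveEnergy` files). -/
private theorem energyDensity_he₁ (hψ : ContDiff ℝ 2 (Function.uncurry ψ)) :
    ∀ z : ℝ × ℝ, (fun z : ℝ × ℝ ↦ energyDensity V ψ z.1 z.2) z
      = (fderiv ℝ (Function.uncurry ψ) z (1, 0)) ^ 2 + (fderiv ℝ (Function.uncurry ψ) z (0, 1)) ^ 2
        + V z.2 * Function.uncurry ψ z ^ 2 := by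
  rintro ⟨t, x⟩
  simp only [Function.uncurry_apply_pair]
  unfold energyDensity
  rw [WaveEnergy.deriv_slice_fst_eq hψ, WaveEnergy.deriv_slice_snd_eq hψ]

/-- Dictionary (`hsol` format of the `WaveEnergy` files). -/
private theorem fderiv_eq₁ (hψ : IsSolution V ψ) :
    ∀ z : ℝ × ℝ, fderiv ℝ (fderiv ℝ (Function.uncurry ψ)) z (1, 0) (1, 0)
      - fderiv ℝ (fderiv ℝ (Function.uncurry ψ)) z (0, 1) (0, 1) + V z.2 * Function.uncurry ψ z = 0 := by
  rintro ⟨t, x⟩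
  rw [← WaveEnergy.iteratedDeriv_two_slice_fst_eq hψ.1, ← WaveEnergy.iteratedDeriv_two_slice_snd_eq hψ.1]
  exact hψ.2 (t, x)

/-- Half-line energies are bounded by the total energy at any other time. -/
private theorem setLIntegral_Ioi_le_totalEnergy₁ (hV : Differentiable ℝ V) (hV0 : ∀ x, 0 ≤ V x)
    (hψ : IsSolution V ψ) (c t₁ t₂ : ℝ) :
    ∫⁻ x in Ioi c, ENNReal.ofReal (energyDensity V ψ t₁ x) ≤ totalEnergy V ψ t₂ := by
  have he := energyDensity_he₁ (V := V) hψ.1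
  have hsol := fderiv_eq₁ hψ
  rcases le_total t₁ t₂ with h | h
  · exact (WaveEnergy.lintegral_Ioi_le_expanding hψ.1 hV hV0 hsol he c h).trans
      (setLIntegral_le_lintegral _ _)
  · have key := WaveEnergy.lintegral_Ioi_shrinking_le hψ.1 hV hV0 hsol he (c - (t₁ - t₂)) h
    rw [show c - (t₁ - t₂) + (t₁ - t₂) = c by ring] at key
    exact key.trans (setLIntegral_le_lintegral _ _)

/-- Conservation of the total energy (private copy of `RW.totalEnergy_eq_totalEnergy`). -/
private theorem totalEnergy_eq_totalEnergy₁ (hV : Differentiable ℝ V) (hV0 : ∀ x, 0 ≤ V x)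
    (hψ : IsSolution V ψ) (t₁ t₂ : ℝ) : totalEnergy V ψ t₁ = totalEnergy V ψ t₂ := by
  have hdir : Directed (· ⊆ ·) (fun n : ℕ ↦ Ioi (-(n : ℝ))) := by
    refine Monotone.directed_le fun i j hij ↦ Ioi_subset_Ioi ?_
    exact neg_le_neg (Nat.cast_le.mpr hij)
  have hU : (⋃ n : ℕ, Ioi (-(n : ℝ))) = univ := by
    refine eq_univ_of_forall fun x ↦ ?_
    obtain ⟨n, hn⟩ := exists_nat_gt (-x)
    exact mem_iUnion.2 ⟨n, by simp only [mem_Ioi]; linarith⟩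
  have hsup : ∀ t, totalEnergy V ψ t
      = ⨆ n : ℕ, ∫⁻ x in Ioi (-(n : ℝ)), ENNReal.ofReal (energyDensity V ψ t x) := fun t ↦ by
    unfold totalEnergy
    rw [← setLIntegral_univ, ← hU, setLIntegral_iUnion_of_directed _ hdir]
  apply le_antisymm
  · rw [hsup t₁]
    exact iSup_le fun n ↦ setLIntegral_Ioi_le_totalEnergy₁ hV hV0 hψ _ t₁ t₂
  · rw [hsup t₂]
    exact iSup_le fun n ↦ setLIntegral_Ioi_le_totalEnergy₁ hV hV0 hψ _ t₂ t₁

/-- Time shifts of global solutions are global solutions (private copy of `RW.IsSolution.shift`). -/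
private theorem shift₁ (hψ : IsSolution V ψ) (T : ℝ) : IsSolution V (fun s y ↦ ψ (T + s) y) := by
  refine ⟨?_, fun z ↦ ?_⟩
  · have h : Function.uncurry (fun s y ↦ ψ (T + s) y)
        = Function.uncurry ψ ∘ fun p : ℝ × ℝ ↦ (T + p.1, p.2) := by
      funext p
      rfl
    rw [h]
    exact hψ.1.comp ((contDiff_const.add contDiff_fst).prodMk contDiff_snd)
  · show iteratedDeriv 2 (fun τ ↦ ψ (T + τ) z.2) z.1 - iteratedDeriv 2 (fun y ↦ ψ (T + z.1) y) z.2
      + V z.2 * ψ (T + z.1) z.2 = 0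
    rw [iteratedDeriv_comp_const_add 2 (fun τ ↦ ψ τ z.2) T]
    exact hψ.2 (T + z.1, z.2)

/-- Energy density of the time-shifted function (private copy of `RW.energyDensity_shift`). -/
private theorem energyDensity_shift₁ (V : ℝ → ℝ) (ψ : ℝ → ℝ → ℝ) (T t x : ℝ) :
    energyDensity V (fun s y ↦ ψ (T + s) y) t x = energyDensity V ψ (T + t) x := by
  unfold energyDensity
  rw [deriv_comp_const_add (fun σ ↦ ψ σ x) T t]

/-! ### The energy inside a light cone is the flux through its sheets -/

/-- The inward null energy densities `(ψ_t ± ψ_x)² + Vψ²` (Fréchet form, sign `κ`) are continuous and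
non-negative. [folklore] -/
theorem continuous_inwardDensity (hV : Differentiable ℝ V) (hψ : ContDiff ℝ 2 (Function.uncurry ψ))
    (κ : ℝ) : Continuous fun z : ℝ × ℝ ↦ (fderiv ℝ (Function.uncurry ψ) z (1, 0)
      + κ * fderiv ℝ (Function.uncurry ψ) z (0, 1)) ^ 2 + V z.2 * Function.uncurry ψ z ^ 2 :=
  (((WaveEnergy.continuous_fderiv_apply hψ (1, 0)).add
    (continuous_const.mul (WaveEnergy.continuous_fderiv_apply hψ (0, 1)))).pow 2).add
    ((hV.continuous.comp continuous_snd).mul (hψ.continuous.pow 2))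

/-- **Energy inside the cone = flux through the sheets.** For a global `C²` solution (`V` differentiable),
a centre `xc` and times `B`, `t`: the energy on `[xc − t, xc + t]` at time `B + t` equals
`∫_0^t [((ψ_t+ψ_x)² + Vψ²)(B+σ, xc+σ) + ((ψ_t−ψ_x)² + Vψ²)(B+σ, xc−σ)] dσ`. [folklore] -/
theorem integral_coneInterior_eq_flux (hV : Differentiable ℝ V) (hψ : IsSolution V ψ) (xc B t : ℝ) :
    ∫ x in (xc - t)..(xc + t), energyDensity V ψ (B + t) x
      = ∫ σ in (0 : ℝ)..t,
        (((fderiv ℝ (Function.uncurry ψ) (B + σ, xc + σ) (1, 0)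
            + 1 * fderiv ℝ (Function.uncurry ψ) (B + σ, xc + σ) (0, 1)) ^ 2
          + V (xc + σ) * Function.uncurry ψ (B + σ, xc + σ) ^ 2)
        + ((fderiv ℝ (Function.uncurry ψ) (B + σ, xc - σ) (1, 0)
            + (-1) * fderiv ℝ (Function.uncurry ψ) (B + σ, xc - σ) (0, 1)) ^ 2
          + V (xc - σ) * Function.uncurry ψ (B + σ, xc - σ) ^ 2)) := by
  have hu := hψ.1
  have he := energyDensity_he₁ (V := V) hu
  have he' : ∀ τ y, energyDensity V ψ τ y = (fderiv ℝ (Function.uncurry ψ) (τ, y) (1, 0)) ^ 2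
      + (fderiv ℝ (Function.uncurry ψ) (τ, y) (0, 1)) ^ 2 + V y * Function.uncurry ψ (τ, y) ^ 2 :=
    fun τ y ↦ he (τ, y)
  have hm : ∀ z : ℝ × ℝ, (fun z : ℝ × ℝ ↦ 2 * fderiv ℝ (Function.uncurry ψ) z (1, 0)
      * fderiv ℝ (Function.uncurry ψ) z (0, 1)) z
      = 2 * fderiv ℝ (Function.uncurry ψ) z (1, 0) * fderiv ℝ (Function.uncurry ψ) z (0, 1) :=
    fun z ↦ rfl
  set U := Function.uncurry ψ with hU
  set H : ℝ → ℝ := fun τ ↦ ((fderiv ℝ U (τ, xc - B + τ) (1, 0) + 1 * fderiv ℝ U (τ, xc - B + τ) (0, 1)) ^ 2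
      + V (xc - B + τ) * U (τ, xc - B + τ) ^ 2) + ((fderiv ℝ U (τ, xc + B - τ) (1, 0)
      + (-1) * fderiv ℝ U (τ, xc + B - τ) (0, 1)) ^ 2 + V (xc + B - τ) * U (τ, xc + B - τ) ^ 2) with hH
  have key := WaveEnergy.energy_identity_affine hu hV (fderiv_eq₁ hψ) he hm (xc + B) (-1) (xc - B) 1
    B (B + t)
  simp only [show xc + B + -1 * (B + t) = xc - t by ring, show xc - B + 1 * (B + t) = xc + t by ring,
    show xc + B + -1 * B = xc by ring, show xc - B + 1 * B = xc by ring, intervalIntegral.integral_same,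
    sub_zero] at key
  rw [key]
  symm
  calc _ = ∫ σ in (0 : ℝ)..t, H (B + σ) := by
        refine intervalIntegral.integral_congr fun σ _ ↦ ?_
        simp only [hH, show xc - B + (B + σ) = xc + σ by ring, show xc + B - (B + σ) = xc - σ by ring]
    _ = ∫ τ in (B + 0)..(B + t), H τ := intervalIntegral.integral_comp_add_left H B
    _ = ∫ τ in B..(B + t), H τ := by rw [add_zero]
    _ = _ := by
        refine intervalIntegral.integral_congr fun τ _ ↦ ?_
        simp only [hH, he', show xc - B + 1 * τ = xc - B + τ by ring,
          show xc + B + -1 * τ = xc + B - τ by ring]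
        ring

/-- **The total energy splits into the exterior energy of the shifted solution and the cone interior.**
For `t ≥ 0`: `E(0) = exteriorEnergy V xc 0 (ψ(B + ·)) t + ofReal (∫_{xc−t}^{xc+t} e(B+t,·))`
(conservation of the total energy + the slice `ℝ = {t < |x − xc|} ∪ [xc − t, xc + t]`). [folklore] -/
theorem totalEnergy_eq_exteriorEnergy_shift_add (hV : Differentiable ℝ V) (hV0 : ∀ x, 0 ≤ V x)
    (hψ : IsSolution V ψ) (xc B : ℝ) {t : ℝ} (ht : 0 ≤ t) :
    totalEnergy V ψ 0 = exteriorEnergy V xc 0 (fun s y ↦ ψ (B + s) y) t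
      + ENNReal.ofReal (∫ x in (xc - t)..(xc + t), energyDensity V ψ (B + t) x) := by
  rw [totalEnergy_eq_totalEnergy₁ hV hV0 hψ 0 (B + t)]
  unfold totalEnergy exteriorEnergy
  have hS : MeasurableSet {x : ℝ | 0 + |t| < |x - xc|} :=
    measurableSet_lt measurable_const (by fun_prop)
  rw [← lintegral_add_compl _ hS]
  congr 1
  · exact lintegral_congr fun x ↦ by rw [energyDensity_shift₁]
  · have hc : {x : ℝ | 0 + |t| < |x - xc|}ᶜ = Icc (xc - t) (xc + t) := by
      ext x
      simp only [mem_compl_iff, mem_setOf_eq, not_lt, mem_Icc, zero_add, abs_of_nonneg ht, abs_le]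
      constructor <;> intro h <;> constructor <;> linarith [h.1, h.2]
    have hec : Continuous fun x ↦ energyDensity V ψ (B + t) x :=
      (WaveEnergy.continuous_energyDensity hψ.1 hV (energyDensity_he₁ hψ.1)).comp
        (Continuous.prodMk_right (B + t))
    rw [hc, setLIntegral_congr (Ioc_ae_eq_Icc (α := ℝ) (μ := volume)).symm,
      WaveEnergy.lintegral_Ioc_eq_ofReal_intervalIntegral hec
        (fun x ↦ energyDensity_nonneg ψ _ (hV0 x)) (by linarith)]

/-! ### From quadrant bounds to exhaustion -/

/-- Fubini for continuous functions on rectangles (interval-integral form). -/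
private theorem swap₁ {F : ℝ × ℝ → ℝ} (hF : Continuous F) (a b c d : ℝ) :
    ∫ x in a..b, ∫ y in c..d, F (x, y) = ∫ y in c..d, ∫ x in a..b, F (x, y) :=
  MeasureTheory.intervalIntegral_intervalIntegral_swap (F := fun x y ↦ F (x, y))
    ((hF.continuousOn.integrableOn_compact (isCompact_uIcc.prod isCompact_uIcc)).mono_set
      (Set.prod_mono Set.uIoc_subset_uIcc Set.uIoc_subset_uIcc))

/-- Parametric interval integrals of continuous functions on `ℝ × ℝ` are continuous in the parameter. -/
private theorem continuous_param₁ {F : ℝ × ℝ → ℝ} (hF : Continuous F) (c d : ℝ) :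
    Continuous fun x ↦ ∫ y in c..d, F (x, y) :=
  intervalIntegral.continuous_parametric_intervalIntegral_of_continuous' (f := fun x y ↦ F (x, y))
    (hF.comp (continuous_fst.prodMk continuous_snd)) c d

/-- **Cone interior bound from quadrant bounds.** If the space-time integrals of `(ψ_t + ψ_x)² + Vψ²` over
the boxes `[0, T] × [xc, R]` and of `(ψ_t − ψ_x)² + Vψ²` over `[0, T] × [L, xc]` are bounded by `Q_R`,
`Q_L` for all `T ≥ 0`, `R ≥ xc`, `L ≤ xc`, then for `B > 0`, `t ≥ 0`:
`B · ∫_{xc−t}^{xc+t} e(B+t,·) ≤ Q_R + Q_L` (the cones of the centres `T ∈ [0, B]` at their times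
`B + t − T + ·` contain the cone of `B` at time `t`; integrate the flux identity over `T`, Fubini,
translate). [folklore] -/
theorem mul_coneInterior_le_of_quadrantBounds (hV : Differentiable ℝ V) (hV0 : ∀ x, 0 ≤ V x)
    (hψ : IsSolution V ψ) {xc QR QL : ℝ}
    (hQR : ∀ T, 0 ≤ T → ∀ R, xc ≤ R → (∫ t in (0 : ℝ)..T, ∫ x in xc..R,
      ((fderiv ℝ (Function.uncurry ψ) (t, x) (1, 0) + 1 * fderiv ℝ (Function.uncurry ψ) (t, x) (0, 1)) ^ 2
        + V x * Function.uncurry ψ (t, x) ^ 2)) ≤ QR)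
    (hQL : ∀ T, 0 ≤ T → ∀ L, L ≤ xc → (∫ t in (0 : ℝ)..T, ∫ x in L..xc,
      ((fderiv ℝ (Function.uncurry ψ) (t, x) (1, 0) + (-1) * fderiv ℝ (Function.uncurry ψ) (t, x) (0, 1)) ^ 2
        + V x * Function.uncurry ψ (t, x) ^ 2)) ≤ QL)
    {B t : ℝ} (hB : 0 < B) (ht : 0 ≤ t) :
    B * ∫ x in (xc - t)..(xc + t), energyDensity V ψ (B + t) x ≤ QR + QL := by
  set U := Function.uncurry ψ with hU
  set FR : ℝ × ℝ → ℝ := fun z ↦ (fderiv ℝ U z (1, 0) + 1 * fderiv ℝ U z (0, 1)) ^ 2 + V z.2 * U z ^ 2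
    with hFR
  set FL : ℝ × ℝ → ℝ := fun z ↦ (fderiv ℝ U z (1, 0) + (-1) * fderiv ℝ U z (0, 1)) ^ 2 + V z.2 * U z ^ 2
    with hFL
  have hFRc : Continuous FR := continuous_inwardDensity hV hψ.1 1
  have hFLc : Continuous FL := continuous_inwardDensity hV hψ.1 (-1)
  have hFR0 : ∀ z, 0 ≤ FR z := fun z ↦ by have := hV0 z.2; positivity
  have hFL0 : ∀ z, 0 ≤ FL z := fun z ↦ by have := hV0 z.2; positivity
  set S := t + B with hS
  have hS0 : 0 ≤ S := by positivity
  have hec : ∀ τ, Continuous fun x ↦ energyDensity V ψ τ x := fun τ ↦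
    (WaveEnergy.continuous_energyDensity hψ.1 hV (energyDensity_he₁ hψ.1)).comp (Continuous.prodMk_right τ)
  have he0 : ∀ τ x, 0 ≤ energyDensity V ψ τ x := fun τ x ↦ energyDensity_nonneg ψ τ (hV0 x)
  -- the flux density through the cone of centre `T`, as a function of `(T, σ)`
  set G : ℝ × ℝ → ℝ := fun p ↦ FR (p.1 + p.2, xc + p.2) + FL (p.1 + p.2, xc - p.2) with hG
  have hGRc : Continuous fun p : ℝ × ℝ ↦ FR (p.1 + p.2, xc + p.2) := by fun_prop
  have hGLc : Continuous fun p : ℝ × ℝ ↦ FL (p.1 + p.2, xc - p.2) := by fun_prop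
  have hGc : Continuous G := hGRc.add hGLc
  have hG0 : ∀ p, 0 ≤ G p := fun p ↦ add_nonneg (hFR0 _) (hFL0 _)
  have hflux : ∀ T s : ℝ, ∫ x in (xc - s)..(xc + s), energyDensity V ψ (T + s) x
      = ∫ σ in (0 : ℝ)..s, G (T, σ) := fun T s ↦ integral_coneInterior_eq_flux hV hψ xc T s
  -- step 1: cone nesting
  have hstep1 : ∀ T ∈ Icc 0 B, (∫ x in (xc - t)..(xc + t), energyDensity V ψ (B + t) x)
      ≤ ∫ σ in (0 : ℝ)..S, G (T, σ) := by
    intro T hT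
    have h1 : t ≤ B + t - T := by linarith [hT.2]
    have h2 : B + t - T ≤ S := by linarith [hT.1]
    calc (∫ x in (xc - t)..(xc + t), energyDensity V ψ (B + t) x)
        ≤ ∫ x in (xc - (B + t - T))..(xc + (B + t - T)), energyDensity V ψ (B + t) x :=
          intervalIntegral.integral_mono_interval (by linarith) (by linarith) (by linarith)
            (Eventually.of_forall fun x ↦ he0 _ x) ((hec _).intervalIntegrable _ _)
      _ = ∫ σ in (0 : ℝ)..(B + t - T), G (T, σ) := by
          rw [← hflux T (B + t - T), show T + (B + t - T) = B + t by ring]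
      _ ≤ ∫ σ in (0 : ℝ)..S, G (T, σ) :=
          intervalIntegral.integral_mono_interval le_rfl (by linarith) h2
            (Eventually.of_forall fun σ ↦ hG0 _) ((hGc.comp (Continuous.prodMk_right T)).intervalIntegrable _ _)
  -- step 2: integrate over the centres `T ∈ [0, B]`
  have hstep2 : B * (∫ x in (xc - t)..(xc + t), energyDensity V ψ (B + t) x)
      ≤ ∫ T in (0 : ℝ)..B, ∫ σ in (0 : ℝ)..S, G (T, σ) := by
    have h : (∫ _ in (0 : ℝ)..B, ∫ x in (xc - t)..(xc + t), energyDensity V ψ (B + t) x)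
        = B * ∫ x in (xc - t)..(xc + t), energyDensity V ψ (B + t) x := by
      rw [intervalIntegral.integral_const, sub_zero, smul_eq_mul]
    rw [← h]
    exact intervalIntegral.integral_mono_on hB.le intervalIntegrable_const
      ((continuous_param₁ hGc 0 S).intervalIntegrable _ _) hstep1
  -- step 3: Fubini and translations, right sheet
  have hR : (∫ T in (0 : ℝ)..B, ∫ σ in (0 : ℝ)..S, FR (T + σ, xc + σ)) ≤ QR := by
    have hc1 : Continuous fun p : ℝ × ℝ ↦ FR (p.2, xc + p.1) := by fun_prop
    have hc2 : Continuous fun p : ℝ × ℝ ↦ FR (p.1, xc + p.2) := by fun_prop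
    calc (∫ T in (0 : ℝ)..B, ∫ σ in (0 : ℝ)..S, FR (T + σ, xc + σ))
        = ∫ σ in (0 : ℝ)..S, ∫ T in (0 : ℝ)..B, FR (T + σ, xc + σ) := swap₁ hGRc 0 B 0 S
      _ ≤ ∫ σ in (0 : ℝ)..S, ∫ τ in (0 : ℝ)..(B + S), FR (τ, xc + σ) := by
          refine intervalIntegral.integral_mono_on hS0
            ((continuous_param₁ (F := fun p : ℝ × ℝ ↦ FR (p.2 + p.1, xc + p.1)) (by fun_prop) 0 B)
              |>.intervalIntegrable _ _) ((continuous_param₁ hc1 0 (B + S)).intervalIntegrable _ _)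
            fun σ hσ ↦ ?_
          rw [intervalIntegral.integral_comp_add_right (fun τ ↦ FR (τ, xc + σ)) σ, zero_add]
          exact intervalIntegral.integral_mono_interval hσ.1 (by linarith) (by linarith [hσ.2])
            (Eventually.of_forall fun τ ↦ hFR0 _)
            ((hFRc.comp (Continuous.prodMk_left (xc + σ))).intervalIntegrable _ _)
      _ = ∫ τ in (0 : ℝ)..(B + S), ∫ σ in (0 : ℝ)..S, FR (τ, xc + σ) := (swap₁ hc2 0 (B + S) 0 S).symm
      _ = ∫ τ in (0 : ℝ)..(B + S), ∫ x in xc..(xc + S), FR (τ, x) := by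
          refine intervalIntegral.integral_congr fun τ _ ↦ ?_
          rw [intervalIntegral.integral_comp_add_left (fun x ↦ FR (τ, x)) xc, add_zero]
      _ ≤ QR := by
          simpa only [hFR] using hQR (B + S) (by positivity) (xc + S) (by linarith)
  -- left sheet
  have hL : (∫ T in (0 : ℝ)..B, ∫ σ in (0 : ℝ)..S, FL (T + σ, xc - σ)) ≤ QL := by
    have hc1 : Continuous fun p : ℝ × ℝ ↦ FL (p.2, xc - p.1) := by fun_prop
    have hc2 : Continuous fun p : ℝ × ℝ ↦ FL (p.1, xc - p.2) := by fun_prop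
    calc (∫ T in (0 : ℝ)..B, ∫ σ in (0 : ℝ)..S, FL (T + σ, xc - σ))
        = ∫ σ in (0 : ℝ)..S, ∫ T in (0 : ℝ)..B, FL (T + σ, xc - σ) := swap₁ hGLc 0 B 0 S
      _ ≤ ∫ σ in (0 : ℝ)..S, ∫ τ in (0 : ℝ)..(B + S), FL (τ, xc - σ) := by
          refine intervalIntegral.integral_mono_on hS0
            ((continuous_param₁ (F := fun p : ℝ × ℝ ↦ FL (p.2 + p.1, xc - p.1)) (by fun_prop) 0 B)
              |>.intervalIntegrable _ _) ((continuous_param₁ hc1 0 (B + S)).intervalIntegrable _ _)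
            fun σ hσ ↦ ?_
          rw [intervalIntegral.integral_comp_add_right (fun τ ↦ FL (τ, xc - σ)) σ, zero_add]
          exact intervalIntegral.integral_mono_interval hσ.1 (by linarith) (by linarith [hσ.2])
            (Eventually.of_forall fun τ ↦ hFL0 _)
            ((hFLc.comp (Continuous.prodMk_left (xc - σ))).intervalIntegrable _ _)
      _ = ∫ τ in (0 : ℝ)..(B + S), ∫ σ in (0 : ℝ)..S, FL (τ, xc - σ) := (swap₁ hc2 0 (B + S) 0 S).symm
      _ = ∫ τ in (0 : ℝ)..(B + S), ∫ x in (xc - S)..xc, FL (τ, x) := by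
          refine intervalIntegral.integral_congr fun τ _ ↦ ?_
          rw [intervalIntegral.integral_comp_sub_left (fun x ↦ FL (τ, x)) xc, sub_zero]
      _ ≤ QL := by
          simpa only [hFL] using hQL (B + S) (by positivity) (xc - S) (by linarith)
  -- combine
  have hsplit : (∫ T in (0 : ℝ)..B, ∫ σ in (0 : ℝ)..S, G (T, σ))
      = (∫ T in (0 : ℝ)..B, ∫ σ in (0 : ℝ)..S, FR (T + σ, xc + σ))
        + ∫ T in (0 : ℝ)..B, ∫ σ in (0 : ℝ)..S, FL (T + σ, xc - σ) := by
    rw [← intervalIntegral.integral_add ((continuous_param₁ hGRc 0 S).intervalIntegrable _ _)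
      ((continuous_param₁ hGLc 0 S).intervalIntegrable _ _)]
    refine intervalIntegral.integral_congr fun T _ ↦ ?_
    exact intervalIntegral.integral_add ((hGRc.comp (Continuous.prodMk_right T)).intervalIntegrable _ _)
      ((hGLc.comp (Continuous.prodMk_right T)).intervalIntegrable _ _)
  linarith

/-- **Outgoing-energy exhaustion from quadrant bounds (H4 for such solutions).** Let `V ≥ 0` be
differentiable and `ψ` a global `C²` solution of `ψ_tt − ψ_xx + Vψ = 0` whose inward null energies have
bounded space-time integrals over the two quadrants based at `xc` (hypotheses `hQR`, `hQL` as in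
`mul_coneInterior_le_of_quadrantBounds`).  Then the forward channel energy of `ψ(B + ·)` through the bare
light cone about `xc` tends to the total energy as `B → +∞`. [folklore] -/
theorem tendsto_channelEnergy_shift_of_quadrantBounds (hV : Differentiable ℝ V) (hV0 : ∀ x, 0 ≤ V x)
    (hψ : IsSolution V ψ) {xc QR QL : ℝ}
    (hQR : ∀ T, 0 ≤ T → ∀ R, xc ≤ R → (∫ t in (0 : ℝ)..T, ∫ x in xc..R,
      ((fderiv ℝ (Function.uncurry ψ) (t, x) (1, 0) + 1 * fderiv ℝ (Function.uncurry ψ) (t, x) (0, 1)) ^ 2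
        + V x * Function.uncurry ψ (t, x) ^ 2)) ≤ QR)
    (hQL : ∀ T, 0 ≤ T → ∀ L, L ≤ xc → (∫ t in (0 : ℝ)..T, ∫ x in L..xc,
      ((fderiv ℝ (Function.uncurry ψ) (t, x) (1, 0) + (-1) * fderiv ℝ (Function.uncurry ψ) (t, x) (0, 1)) ^ 2
        + V x * Function.uncurry ψ (t, x) ^ 2)) ≤ QL) :
    Tendsto (fun B ↦ channelEnergy V xc 0 (fun t x ↦ ψ (B + t) x) atTop) atTop
      (𝓝 (totalEnergy V ψ 0)) := by
  -- upper bound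
  have hup : ∀ B, channelEnergy V xc 0 (fun t x ↦ ψ (B + t) x) atTop ≤ totalEnergy V ψ 0 := fun B ↦ by
    rw [channelEnergy_atTop_eq_iInf hV hV0 (shift₁ hψ B) xc le_rfl,
      totalEnergy_eq_exteriorEnergy_shift_add hV hV0 hψ xc B le_rfl]
    exact (iInf₂_le (0 : ℝ) (mem_Ici.2 le_rfl)).trans le_self_add
  -- lower bound for `B > 0`
  have hlow : ∀ B, 0 < B → totalEnergy V ψ 0 - ENNReal.ofReal ((QR + QL) / B)
      ≤ channelEnergy V xc 0 (fun t x ↦ ψ (B + t) x) atTop := by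
    intro B hB
    rw [channelEnergy_atTop_eq_iInf hV hV0 (shift₁ hψ B) xc le_rfl]
    refine le_iInf₂ fun t ht ↦ ?_
    rw [mem_Ici] at ht
    rw [tsub_le_iff_right, totalEnergy_eq_exteriorEnergy_shift_add hV hV0 hψ xc B ht]
    gcongr
    rw [le_div_iff₀ hB, mul_comm]
    exact mul_coneInterior_le_of_quadrantBounds hV hV0 hψ hQR hQL hB ht
  -- squeeze
  have hq : Tendsto (fun B : ℝ ↦ ENNReal.ofReal ((QR + QL) / B)) atTop (𝓝 0) := by
    have h := ENNReal.tendsto_ofReal ((tendsto_const_nhds (x := QR + QL)).div_atTop tendsto_id)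
    rwa [ENNReal.ofReal_zero] at h
  have hl : Tendsto (fun B ↦ totalEnergy V ψ 0 - ENNReal.ofReal ((QR + QL) / B)) atTop
      (𝓝 (totalEnergy V ψ 0)) := by
    have h := ENNReal.Tendsto.sub (tendsto_const_nhds (x := totalEnergy V ψ 0)) hq
      (Or.inr ENNReal.zero_ne_top)
    rwa [tsub_zero] at h
  refine tendsto_of_tendsto_of_tendsto_of_le_of_le' hl tendsto_const_nhds ?_ (Eventually.of_forall hup)
  filter_upwards [eventually_gt_atTop 0] with B hB using hlow B hB

/-- **Registered sub-goal `stub_h4ExhaustionOfQuadrantBounds`** (crux stmt-FinalStateConjecture-14075, line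
`isolated-kerr-connected-hull`, towards `stub_compactExhaustionOfLocalDecay`): outgoing-energy exhaustion for
global solutions whose inward null energies have bounded space-time integrals over the two quadrants.
[folklore] -/
theorem stub_h4ExhaustionOfQuadrantBounds : ∀ (V : ℝ → ℝ), Differentiable ℝ V → (∀ x, 0 ≤ V x) →
    ∀ ψ : ℝ → ℝ → ℝ, ReggeWheeler.IsSolution V ψ → ∀ (xc QR QL : ℝ),
    (∀ T : ℝ, 0 ≤ T → ∀ R : ℝ, xc ≤ R → (∫ t in (0:ℝ)..T, ∫ x in xc..R,
      ((fderiv ℝ (Function.uncurry ψ) (t, x) (1, 0) + 1 * fderiv ℝ (Function.uncurry ψ) (t, x) (0, 1)) ^ 2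
        + V x * Function.uncurry ψ (t, x) ^ 2)) ≤ QR) →
    (∀ T : ℝ, 0 ≤ T → ∀ L : ℝ, L ≤ xc → (∫ t in (0:ℝ)..T, ∫ x in L..xc,
      ((fderiv ℝ (Function.uncurry ψ) (t, x) (1, 0) + (-1) * fderiv ℝ (Function.uncurry ψ) (t, x) (0, 1)) ^ 2
        + V x * Function.uncurry ψ (t, x) ^ 2)) ≤ QL) →
    Filter.Tendsto (fun B ↦ ReggeWheeler.channelEnergy V xc 0 (fun t x ↦ ψ (B + t) x) Filter.atTop)
      Filter.atTop (nhds (ReggeWheeler.totalEnergy V ψ 0)) :=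
  fun _ hV hV0 _ hψ _ _ _ hQR hQL ↦ tendsto_channelEnergy_shift_of_quadrantBounds hV hV0 hψ hQR hQL

end General

end RW

end

end Summit.FinalStateConjecture.FinalStateConjecture.Theorems
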